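import Summits.QuantumFields.YangMills.Theorems.BalabanUVNodesN15TwoSpacingGluingCurvedKnitObjects
import HarnessLib

/-!
# N15 = NE2, road (c) — PROGRAMME (PC), towards (PC-A″) «the THIRD sup-norm entry `G′(U)∇*_U` of [B9] (3.42) in per-cube gauges», IIIc: THE SMALLNESS ARITHMETIC OF THE ADJOINT KNIT AT
# THE COVER — n15-c∕281's three smallness conditions and its majorant constant from `W = L^m ≥ w₀`, the letters `≤ R`, the far letter `≤ θ₀` (the adjoint twin of n15-c∕119 `cvSmall`)
# (dag-n15-c g27, n15-c∕282c)

Cell `pub-ymgap`, seat `pub-ymgap-dag-n15-c` (generation g27; R134 (a), s1; HUMAN RULING D-0062).  `bears_on: R4∕N15 · K3⁸ SpineGivenEndpointR13SepCoPHV (stmt-QuantumFields-27366)`;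
filed `--kind proof --supports stmt-QuantumFields-27366 --as helper` — COUNT-NEUTRAL.  Real arithmetic only; 0 `def`, 0 `sorry`.  Imports n15-c∕119 `…TwoSpacingGluingCurvedKnitObjects` (for
the namespace and `cvSmall`'s conventions only).  Nothing in the tree is modified.

WHAT.  ★ `adjSmall`: in the letters of n15-c∕281 read at the cover (`c̃ = c₀ = c₁ = π∕w`, `c₂ = 32π²∕w²`, `c_N = 2πD∕w·c_{N₀}`, `ℓ = ω = πD∕w`, `θ_W = ε_F = 0`), from `β̄_wRc_r² ≤ 1∕2`,
`θ_Ac_r ≤ 1∕2`, `w ≥ 1`, `r_V, R_N ≤ R ≤ 1`, the far letter's budget `N_ovc_ι²c_r·(2β̄_π)θ_Fc_r ≤ 1∕4` and `w ≥ 4N_ovc_ι²c_rA`: (i) 281's `hqL` (`N_ov(c_ι²Θ + c_ι²·0)c_r < 1`), (ii)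
`(1 − …)⁻¹ ≤ 2`, (iii) the majorant constant `≤ 2N_ov(c_ι²(2β^Qc_r·r_R + 2β̄_π(r_{∇R} + r_B)) + c_ι²·2β̄_ππ)c_r`.  ★ `adjThetaA_le`: `θ_A ≤ (β + |J|·2(β^Q + 2β) + βc_r)·R` from
`r_V, r_D, R_N ≤ R`, `c̃ ≤ 1`.

HONEST FRAMING ∕ LIMITS.  Elementary inequalities; no operator, no estimate of any propagator; nothing of [B9] asserted.  NE2⁺ NOT PRINTED, NOT proved; N15 of record untouched; K3⁸ OPEN;
counts UNMOVED.  Restate-immune.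
-/

noncomputable section

namespace Summit.QuantumFields.YangMills.BalabanUVNodes.N15.Gluing

open Real

/-- ★ `θ_A ≤ (β + c_J·2(β^Q + 2β) + βc_r)·R` when `r_V, r_D, R_N ≤ R`, `0 ≤ c̃ ≤ 1` (n15-c∕281's adjoint letter budget). [folklore] -/
theorem adjThetaA_le {β βQ cJ cr ct rV rD RN R : ℝ} (hβ : 0 ≤ β) (hβQ : 0 ≤ βQ) (hcJ : 0 ≤ cJ) (hcr : 0 ≤ cr) (hct1 : ct ≤ 1) (hrV : 0 ≤ rV)
    (hrVR : rV ≤ R) (hrDR : rD ≤ R) (hRNR : RN ≤ R) :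
    β * rV + cJ * (2 * (βQ * rV + β * (rD + ct * rV))) + β * RN * cr ≤ (β + cJ * (2 * (βQ + 2 * β)) + β * cr) * R := by
  have hR : 0 ≤ R := hrV.trans hrVR
  have h3 : ct * rV ≤ R := by nlinarith
  have h4 : rD + ct * rV ≤ 2 * R := by linarith
  have e : (β + cJ * (2 * (βQ + 2 * β)) + β * cr) * R = β * R + cJ * (2 * (βQ * R + β * (2 * R))) + β * R * cr := by ring
  rw [e]
  gcongr

set_option maxHeartbeats 1600000 in
/-- ★ **THE SMALLNESS ARITHMETIC OF THE ADJOINT KNIT AT THE COVER** (n15-c∕281's `hqL`, its resummation factor and its majorant constant, in the cover's letters).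
[cite: Balaban1984PropagatorsII, (2.135) p.247 («O(M⁻¹)», mechanism); Balaban1985BackgroundPropagators, Thm 3.1 p.397 (the guard `M ≥ M₁`)] -/
theorem adjSmall {Nov cr cι2 cJ β β₁ βQ w R θF θA rV RN rR rR' rB ε cN₀ D : ℝ} (hNov : 0 ≤ Nov) (hcr : 0 ≤ cr) (hcι : 0 ≤ cι2) (hcJ : 0 ≤ cJ) (hβ : 0 ≤ β) (hβ₁ : 0 ≤ β₁)
    (hβQ : 0 ≤ βQ) (hw : 1 ≤ w) (hR : 0 ≤ R) (hθF : 0 ≤ θF) (hε : 0 < ε) (hcN₀ : 0 ≤ cN₀) (hD : 0 ≤ D) (hRN : 0 ≤ RN) (hrVR : rV ≤ R) (hRNR : RN ≤ R)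
    (hrR : 0 ≤ rR) (hrR' : 0 ≤ rR') (hrB : 0 ≤ rB)
    (hq₀ : (β + (β₁ + π / w * β)) * (R * cr) * cr ≤ 1 / 2) (hθA : θA * cr ≤ 1 / 2)
    (hθ : Nov * cr * (cι2 * ((2 * (β + (β₁ + π * β))) * θF * cr)) ≤ 1 / 4)
    (hW : 4 * (Nov * cr * (cι2 * (cJ * (3 * (2 * (β + (β₁ + π * β))) * (32 * π ^ 2) + 2 * (2 * βQ * cr) * π) + (2 * (β + (β₁ + π * β))) * (2 * (π * D) * cN₀) * cr +
      cJ * (2 * R * (π * (2 * (β + (β₁ + π * β))) + π * (2 * βQ * cr))) + (2 * (β + (β₁ + π * β))) * ((π * D * (Real.exp 1 * ε)⁻¹ + 2 * (π * D)) * R) * cr))) ≤ w) :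
    Nov * (cι2 * (((((cJ * (3 * ((β + (β₁ + (π / w) * β)) * (1 - (β + (β₁ + (π / w) * β)) * (R * cr) * cr)⁻¹ * (32 * π ^ 2 / w ^ 2)) + 2 * (((1 - θA * cr)⁻¹ * βQ * cr) * (π / w))) + 0)
          + (β + (β₁ + (π / w) * β)) * (1 - (β + (β₁ + (π / w) * β)) * (R * cr) * cr)⁻¹ * ((π * D / w * 0 + 2 * (π * D / w)) * cN₀) * cr)
        + ((cJ * (2 * rV * ((π / w) * ((β + (β₁ + (π / w) * β)) * (1 - (β + (β₁ + (π / w) * β)) * (R * cr) * cr)⁻¹) + (π / w) * ((1 - θA * cr)⁻¹ * βQ * cr))))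
          + (β + (β₁ + (π / w) * β)) * (1 - (β + (β₁ + (π / w) * β)) * (R * cr) * cr)⁻¹ * (((π * D / w) * (Real.exp 1 * ε)⁻¹ + 2 * (π * D / w)) * RN) * cr))) + (((β + (β₁ + (π / w) * β)) * (1 - (β + (β₁ + (π / w) * β)) * (R * cr) * cr)⁻¹) * θF * cr)) + cι2 * 0) * cr < 1 ∧
    (1 - Nov * (cι2 * (((((cJ * (3 * ((β + (β₁ + (π / w) * β)) * (1 - (β + (β₁ + (π / w) * β)) * (R * cr) * cr)⁻¹ * (32 * π ^ 2 / w ^ 2)) + 2 * (((1 - θA * cr)⁻¹ * βQ * cr) * (π / w))) + 0)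
          + (β + (β₁ + (π / w) * β)) * (1 - (β + (β₁ + (π / w) * β)) * (R * cr) * cr)⁻¹ * ((π * D / w * 0 + 2 * (π * D / w)) * cN₀) * cr)
        + ((cJ * (2 * rV * ((π / w) * ((β + (β₁ + (π / w) * β)) * (1 - (β + (β₁ + (π / w) * β)) * (R * cr) * cr)⁻¹) + (π / w) * ((1 - θA * cr)⁻¹ * βQ * cr))))
          + (β + (β₁ + (π / w) * β)) * (1 - (β + (β₁ + (π / w) * β)) * (R * cr) * cr)⁻¹ * (((π * D / w) * (Real.exp 1 * ε)⁻¹ + 2 * (π * D / w)) * RN) * cr))) + (((β + (β₁ + (π / w) * β)) * (1 - (β + (β₁ + (π / w) * β)) * (R * cr) * cr)⁻¹) * θF * cr)) + cι2 * 0) * cr)⁻¹ ≤ 2 ∧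
    (1 - Nov * (cι2 * (((((cJ * (3 * ((β + (β₁ + (π / w) * β)) * (1 - (β + (β₁ + (π / w) * β)) * (R * cr) * cr)⁻¹ * (32 * π ^ 2 / w ^ 2)) + 2 * (((1 - θA * cr)⁻¹ * βQ * cr) * (π / w))) + 0)
          + (β + (β₁ + (π / w) * β)) * (1 - (β + (β₁ + (π / w) * β)) * (R * cr) * cr)⁻¹ * ((π * D / w * 0 + 2 * (π * D / w)) * cN₀) * cr)
        + ((cJ * (2 * rV * ((π / w) * ((β + (β₁ + (π / w) * β)) * (1 - (β + (β₁ + (π / w) * β)) * (R * cr) * cr)⁻¹) + (π / w) * ((1 - θA * cr)⁻¹ * βQ * cr))))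
          + (β + (β₁ + (π / w) * β)) * (1 - (β + (β₁ + (π / w) * β)) * (R * cr) * cr)⁻¹ * (((π * D / w) * (Real.exp 1 * ε)⁻¹ + 2 * (π * D / w)) * RN) * cr))) + (((β + (β₁ + (π / w) * β)) * (1 - (β + (β₁ + (π / w) * β)) * (R * cr) * cr)⁻¹) * θF * cr)) + cι2 * 0) * cr)⁻¹ * (Nov * (cι2 * (((1 - θA * cr)⁻¹ * βQ * cr) * rR + ((β + (β₁ + (π / w) * β)) * (1 - (β + (β₁ + (π / w) * β)) * (R * cr) * cr)⁻¹) * rR' + ((β + (β₁ + (π / w) * β)) * (1 - (β + (β₁ + (π / w) * β)) * (R * cr) * cr)⁻¹) * rB) * 1 + cι2 * ((β + (β₁ + (π / w) * β)) * (1 - (β + (β₁ + (π / w) * β)) * (R * cr) * cr)⁻¹) * (π / w))) * cr ≤ 2 * (Nov * (cι2 * ((2 * βQ * cr) * rR + (2 * (β + (β₁ + π * β))) * rR' + (2 * (β + (β₁ + π * β))) * rB) + cι2 * (2 * (β + (β₁ + π * β))) * π) * cr) := by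
  have hw0 : 0 < w := by linarith
  have hπw : π / w ≤ π := div_le_self pi_pos.le hw
  have hπw0 : 0 ≤ π / w := div_nonneg pi_pos.le hw0.le
  have hπw1 : π / w * (1:ℝ) ≤ π := by linarith
  -- the two resummed letters `P = β̄_w(1 − q₀)⁻¹ ≤ 2β̄_π`, `X = (1 − θ_Ac_r)⁻¹β^Qc_r ≤ 2β^Qc_r`
  set q₀ : ℝ := (β + (β₁ + π / w * β)) * (R * cr) * cr with hq₀def
  have hinv : (1 - q₀)⁻¹ ≤ 2 := by
    calc (1 - q₀)⁻¹ ≤ (1 / 2)⁻¹ := inv_anti₀ (by norm_num) (by linarith)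
      _ = 2 := by norm_num
  have hinv0 : 0 ≤ (1 - q₀)⁻¹ := inv_nonneg.mpr (by linarith)
  have hβs : β + (β₁ + π / w * β) ≤ β + (β₁ + π * β) := by nlinarith [mul_le_mul_of_nonneg_right hπw hβ]
  have hβs0 : 0 ≤ β + (β₁ + π / w * β) := by positivity
  set P : ℝ := (β + (β₁ + π / w * β)) * (1 - q₀)⁻¹ with hPdef
  set P₂ : ℝ := 2 * (β + (β₁ + π * β)) with hP₂def
  have hP0 : 0 ≤ P := mul_nonneg hβs0 hinv0
  have hP : P ≤ P₂ := by
    calc P ≤ (β + (β₁ + π * β)) * 2 := mul_le_mul hβs hinv hinv0 (by positivity)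
      _ = P₂ := by ring
  have hP₂0 : 0 ≤ P₂ := hP0.trans hP
  set X : ℝ := (1 - θA * cr)⁻¹ * βQ * cr with hXdef
  set X₂ : ℝ := 2 * βQ * cr with hX₂def
  have hXi : (1 - θA * cr)⁻¹ ≤ 2 := by
    calc (1 - θA * cr)⁻¹ ≤ (1 / 2)⁻¹ := inv_anti₀ (by norm_num) (by linarith)
      _ = 2 := by norm_num
  have hXi0 : 0 ≤ (1 - θA * cr)⁻¹ := inv_nonneg.mpr (by linarith)
  have hX0 : 0 ≤ X := by positivity
  have hX : X ≤ X₂ := by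
    have := mul_le_mul_of_nonneg_right hXi (mul_nonneg hβQ hcr)
    calc X = (1 - θA * cr)⁻¹ * (βQ * cr) := by ring
      _ ≤ 2 * (βQ * cr) := this
      _ = X₂ := by ring
  have hX₂0 : 0 ≤ X₂ := hX0.trans hX
  -- `1/w² ≤ 1/w`, letters `≤ R`
  have hw2 : 32 * π ^ 2 / w ^ 2 ≤ 32 * π ^ 2 / w := by
    rw [div_le_div_iff_of_pos_left (by positivity) (by positivity) hw0]; nlinarith
  have hw20 : 0 ≤ 32 * π ^ 2 / w ^ 2 := by positivity
  have hDw0 : 0 ≤ π * D / w := by positivity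
  -- the big letter, bounded by `A∕w + P₂θ_Fc_r`
  set A : ℝ := cJ * (3 * P₂ * (32 * π ^ 2) + 2 * X₂ * π) + P₂ * (2 * (π * D) * cN₀) * cr +
      cJ * (2 * R * (π * P₂ + π * X₂)) + P₂ * ((π * D * (Real.exp 1 * ε)⁻¹ + 2 * (π * D)) * R) * cr with hAdef
  have hA0 : 0 ≤ A := by positivity
  have hΘ : (((((cJ * (3 * (P * (32 * π ^ 2 / w ^ 2)) + 2 * (X * (π / w))) + 0)
          + P * ((π * D / w * 0 + 2 * (π * D / w)) * cN₀) * cr)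
        + ((cJ * (2 * rV * ((π / w) * P + (π / w) * X)))
          + P * (((π * D / w) * (Real.exp 1 * ε)⁻¹ + 2 * (π * D / w)) * RN) * cr))) + (P * θF * cr)) ≤ A / w + P₂ * θF * cr := by
    have hΘa : (((((cJ * (3 * (P * (32 * π ^ 2 / w ^ 2)) + 2 * (X * (π / w))) + 0)
          + P * ((π * D / w * 0 + 2 * (π * D / w)) * cN₀) * cr)
        + ((cJ * (2 * rV * ((π / w) * P + (π / w) * X)))
          + P * (((π * D / w) * (Real.exp 1 * ε)⁻¹ + 2 * (π * D / w)) * RN) * cr))) + (P * θF * cr)) ≤ (((((cJ * (3 * (P₂ * (32 * π ^ 2 / w ^ 2)) + 2 * (X₂ * (π / w))) + 0)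
          + P₂ * ((π * D / w * 0 + 2 * (π * D / w)) * cN₀) * cr)
        + ((cJ * (2 * R * ((π / w) * P₂ + (π / w) * X₂)))
          + P₂ * (((π * D / w) * (Real.exp 1 * ε)⁻¹ + 2 * (π * D / w)) * R) * cr))) + (P₂ * θF * cr)) := by
      gcongr
    have hΘb : (((((cJ * (3 * (P₂ * (32 * π ^ 2 / w ^ 2)) + 2 * (X₂ * (π / w))) + 0)
          + P₂ * ((π * D / w * 0 + 2 * (π * D / w)) * cN₀) * cr)
        + ((cJ * (2 * R * ((π / w) * P₂ + (π / w) * X₂)))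
          + P₂ * (((π * D / w) * (Real.exp 1 * ε)⁻¹ + 2 * (π * D / w)) * R) * cr))) + (P₂ * θF * cr)) ≤ (((((cJ * (3 * (P₂ * (32 * π ^ 2 / w)) + 2 * (X₂ * (π / w))) + 0)
          + P₂ * ((π * D / w * 0 + 2 * (π * D / w)) * cN₀) * cr)
        + ((cJ * (2 * R * ((π / w) * P₂ + (π / w) * X₂)))
          + P₂ * (((π * D / w) * (Real.exp 1 * ε)⁻¹ + 2 * (π * D / w)) * R) * cr))) + (P₂ * θF * cr)) := by
      gcongr
    have hw0' : w ≠ 0 := hw0.ne'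
    have hΘc : (((((cJ * (3 * (P₂ * (32 * π ^ 2 / w)) + 2 * (X₂ * (π / w))) + 0)
          + P₂ * ((π * D / w * 0 + 2 * (π * D / w)) * cN₀) * cr)
        + ((cJ * (2 * R * ((π / w) * P₂ + (π / w) * X₂)))
          + P₂ * (((π * D / w) * (Real.exp 1 * ε)⁻¹ + 2 * (π * D / w)) * R) * cr))) + (P₂ * θF * cr)) = A / w + P₂ * θF * cr := by
      rw [hAdef]; field_simp; ring
    linarith [hΘa, hΘb, hΘc.le]
  -- the budget
  have hQ : Nov * (cι2 * (((((cJ * (3 * ((β + (β₁ + (π / w) * β)) * (1 - (β + (β₁ + (π / w) * β)) * (R * cr) * cr)⁻¹ * (32 * π ^ 2 / w ^ 2)) + 2 * (((1 - θA * cr)⁻¹ * βQ * cr) * (π / w))) + 0)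
          + (β + (β₁ + (π / w) * β)) * (1 - (β + (β₁ + (π / w) * β)) * (R * cr) * cr)⁻¹ * ((π * D / w * 0 + 2 * (π * D / w)) * cN₀) * cr)
        + ((cJ * (2 * rV * ((π / w) * ((β + (β₁ + (π / w) * β)) * (1 - (β + (β₁ + (π / w) * β)) * (R * cr) * cr)⁻¹) + (π / w) * ((1 - θA * cr)⁻¹ * βQ * cr))))
          + (β + (β₁ + (π / w) * β)) * (1 - (β + (β₁ + (π / w) * β)) * (R * cr) * cr)⁻¹ * (((π * D / w) * (Real.exp 1 * ε)⁻¹ + 2 * (π * D / w)) * RN) * cr))) + (((β + (β₁ + (π / w) * β)) * (1 - (β + (β₁ + (π / w) * β)) * (R * cr) * cr)⁻¹) * θF * cr)) + cι2 * 0) * cr ≤ 1 / 2 := by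
    have h1 : Nov * (cι2 * (((((cJ * (3 * ((β + (β₁ + (π / w) * β)) * (1 - (β + (β₁ + (π / w) * β)) * (R * cr) * cr)⁻¹ * (32 * π ^ 2 / w ^ 2)) + 2 * (((1 - θA * cr)⁻¹ * βQ * cr) * (π / w))) + 0)
          + (β + (β₁ + (π / w) * β)) * (1 - (β + (β₁ + (π / w) * β)) * (R * cr) * cr)⁻¹ * ((π * D / w * 0 + 2 * (π * D / w)) * cN₀) * cr)
        + ((cJ * (2 * rV * ((π / w) * ((β + (β₁ + (π / w) * β)) * (1 - (β + (β₁ + (π / w) * β)) * (R * cr) * cr)⁻¹) + (π / w) * ((1 - θA * cr)⁻¹ * βQ * cr))))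
          + (β + (β₁ + (π / w) * β)) * (1 - (β + (β₁ + (π / w) * β)) * (R * cr) * cr)⁻¹ * (((π * D / w) * (Real.exp 1 * ε)⁻¹ + 2 * (π * D / w)) * RN) * cr))) + (((β + (β₁ + (π / w) * β)) * (1 - (β + (β₁ + (π / w) * β)) * (R * cr) * cr)⁻¹) * θF * cr)) + cι2 * 0) * cr = Nov * cr * cι2 * (((((cJ * (3 * (P * (32 * π ^ 2 / w ^ 2)) + 2 * (X * (π / w))) + 0)
          + P * ((π * D / w * 0 + 2 * (π * D / w)) * cN₀) * cr)
        + ((cJ * (2 * rV * ((π / w) * P + (π / w) * X)))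
          + P * (((π * D / w) * (Real.exp 1 * ε)⁻¹ + 2 * (π * D / w)) * RN) * cr))) + (P * θF * cr)) := by ring
    have h3 : Nov * cr * cι2 * (A / w) ≤ 1 / 4 := by
      rw [show Nov * cr * cι2 * (A / w) = (Nov * cr * (cι2 * A)) / w by ring, div_le_iff₀ hw0]
      linarith [hW]
    have h4 : Nov * cr * cι2 * (P₂ * θF * cr) ≤ 1 / 4 := by
      calc Nov * cr * cι2 * (P₂ * θF * cr) = Nov * cr * (cι2 * (P₂ * θF * cr)) := by ring
        _ ≤ 1 / 4 := hθ
    have h0 : 0 ≤ Nov * cr * cι2 := by positivity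
    calc Nov * (cι2 * (((((cJ * (3 * ((β + (β₁ + (π / w) * β)) * (1 - (β + (β₁ + (π / w) * β)) * (R * cr) * cr)⁻¹ * (32 * π ^ 2 / w ^ 2)) + 2 * (((1 - θA * cr)⁻¹ * βQ * cr) * (π / w))) + 0)
          + (β + (β₁ + (π / w) * β)) * (1 - (β + (β₁ + (π / w) * β)) * (R * cr) * cr)⁻¹ * ((π * D / w * 0 + 2 * (π * D / w)) * cN₀) * cr)
        + ((cJ * (2 * rV * ((π / w) * ((β + (β₁ + (π / w) * β)) * (1 - (β + (β₁ + (π / w) * β)) * (R * cr) * cr)⁻¹) + (π / w) * ((1 - θA * cr)⁻¹ * βQ * cr))))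
          + (β + (β₁ + (π / w) * β)) * (1 - (β + (β₁ + (π / w) * β)) * (R * cr) * cr)⁻¹ * (((π * D / w) * (Real.exp 1 * ε)⁻¹ + 2 * (π * D / w)) * RN) * cr))) + (((β + (β₁ + (π / w) * β)) * (1 - (β + (β₁ + (π / w) * β)) * (R * cr) * cr)⁻¹) * θF * cr)) + cι2 * 0) * cr = Nov * cr * cι2 * (((((cJ * (3 * (P * (32 * π ^ 2 / w ^ 2)) + 2 * (X * (π / w))) + 0)
          + P * ((π * D / w * 0 + 2 * (π * D / w)) * cN₀) * cr)
        + ((cJ * (2 * rV * ((π / w) * P + (π / w) * X)))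
          + P * (((π * D / w) * (Real.exp 1 * ε)⁻¹ + 2 * (π * D / w)) * RN) * cr))) + (P * θF * cr)) := h1
      _ ≤ Nov * cr * cι2 * (A / w + P₂ * θF * cr) := mul_le_mul_of_nonneg_left hΘ h0
      _ = Nov * cr * cι2 * (A / w) + Nov * cr * cι2 * (P₂ * θF * cr) := by ring
      _ ≤ 1 / 4 + 1 / 4 := add_le_add h3 h4
      _ = 1 / 2 := by norm_num
  have hI : (1 - Nov * (cι2 * (((((cJ * (3 * ((β + (β₁ + (π / w) * β)) * (1 - (β + (β₁ + (π / w) * β)) * (R * cr) * cr)⁻¹ * (32 * π ^ 2 / w ^ 2)) + 2 * (((1 - θA * cr)⁻¹ * βQ * cr) * (π / w))) + 0)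
          + (β + (β₁ + (π / w) * β)) * (1 - (β + (β₁ + (π / w) * β)) * (R * cr) * cr)⁻¹ * ((π * D / w * 0 + 2 * (π * D / w)) * cN₀) * cr)
        + ((cJ * (2 * rV * ((π / w) * ((β + (β₁ + (π / w) * β)) * (1 - (β + (β₁ + (π / w) * β)) * (R * cr) * cr)⁻¹) + (π / w) * ((1 - θA * cr)⁻¹ * βQ * cr))))
          + (β + (β₁ + (π / w) * β)) * (1 - (β + (β₁ + (π / w) * β)) * (R * cr) * cr)⁻¹ * (((π * D / w) * (Real.exp 1 * ε)⁻¹ + 2 * (π * D / w)) * RN) * cr))) + (((β + (β₁ + (π / w) * β)) * (1 - (β + (β₁ + (π / w) * β)) * (R * cr) * cr)⁻¹) * θF * cr)) + cι2 * 0) * cr)⁻¹ ≤ 2 := by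
    calc (1 - Nov * (cι2 * (((((cJ * (3 * ((β + (β₁ + (π / w) * β)) * (1 - (β + (β₁ + (π / w) * β)) * (R * cr) * cr)⁻¹ * (32 * π ^ 2 / w ^ 2)) + 2 * (((1 - θA * cr)⁻¹ * βQ * cr) * (π / w))) + 0)
          + (β + (β₁ + (π / w) * β)) * (1 - (β + (β₁ + (π / w) * β)) * (R * cr) * cr)⁻¹ * ((π * D / w * 0 + 2 * (π * D / w)) * cN₀) * cr)
        + ((cJ * (2 * rV * ((π / w) * ((β + (β₁ + (π / w) * β)) * (1 - (β + (β₁ + (π / w) * β)) * (R * cr) * cr)⁻¹) + (π / w) * ((1 - θA * cr)⁻¹ * βQ * cr))))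
          + (β + (β₁ + (π / w) * β)) * (1 - (β + (β₁ + (π / w) * β)) * (R * cr) * cr)⁻¹ * (((π * D / w) * (Real.exp 1 * ε)⁻¹ + 2 * (π * D / w)) * RN) * cr))) + (((β + (β₁ + (π / w) * β)) * (1 - (β + (β₁ + (π / w) * β)) * (R * cr) * cr)⁻¹) * θF * cr)) + cι2 * 0) * cr)⁻¹ ≤ (1 / 2)⁻¹ := inv_anti₀ (by norm_num) (by linarith)
      _ = 2 := by norm_num
  have hI0 : 0 ≤ (1 - Nov * (cι2 * (((((cJ * (3 * ((β + (β₁ + (π / w) * β)) * (1 - (β + (β₁ + (π / w) * β)) * (R * cr) * cr)⁻¹ * (32 * π ^ 2 / w ^ 2)) + 2 * (((1 - θA * cr)⁻¹ * βQ * cr) * (π / w))) + 0)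
          + (β + (β₁ + (π / w) * β)) * (1 - (β + (β₁ + (π / w) * β)) * (R * cr) * cr)⁻¹ * ((π * D / w * 0 + 2 * (π * D / w)) * cN₀) * cr)
        + ((cJ * (2 * rV * ((π / w) * ((β + (β₁ + (π / w) * β)) * (1 - (β + (β₁ + (π / w) * β)) * (R * cr) * cr)⁻¹) + (π / w) * ((1 - θA * cr)⁻¹ * βQ * cr))))
          + (β + (β₁ + (π / w) * β)) * (1 - (β + (β₁ + (π / w) * β)) * (R * cr) * cr)⁻¹ * (((π * D / w) * (Real.exp 1 * ε)⁻¹ + 2 * (π * D / w)) * RN) * cr))) + (((β + (β₁ + (π / w) * β)) * (1 - (β + (β₁ + (π / w) * β)) * (R * cr) * cr)⁻¹) * θF * cr)) + cι2 * 0) * cr)⁻¹ := inv_nonneg.mpr (by linarith)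
  refine ⟨by linarith, hI, ?_⟩
  have hN0 : 0 ≤ (Nov * (cι2 * (((1 - θA * cr)⁻¹ * βQ * cr) * rR + ((β + (β₁ + (π / w) * β)) * (1 - (β + (β₁ + (π / w) * β)) * (R * cr) * cr)⁻¹) * rR' + ((β + (β₁ + (π / w) * β)) * (1 - (β + (β₁ + (π / w) * β)) * (R * cr) * cr)⁻¹) * rB) * 1 + cι2 * ((β + (β₁ + (π / w) * β)) * (1 - (β + (β₁ + (π / w) * β)) * (R * cr) * cr)⁻¹) * (π / w))) := by positivity
  have hF : (Nov * (cι2 * (((1 - θA * cr)⁻¹ * βQ * cr) * rR + ((β + (β₁ + (π / w) * β)) * (1 - (β + (β₁ + (π / w) * β)) * (R * cr) * cr)⁻¹) * rR' + ((β + (β₁ + (π / w) * β)) * (1 - (β + (β₁ + (π / w) * β)) * (R * cr) * cr)⁻¹) * rB) * 1 + cι2 * ((β + (β₁ + (π / w) * β)) * (1 - (β + (β₁ + (π / w) * β)) * (R * cr) * cr)⁻¹) * (π / w))) * cr ≤ Nov * (cι2 * ((2 * βQ * cr) * rR + (2 * (β + (β₁ + π * β))) * rR' + (2 * (β + (β₁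 + π * β))) * rB) + cι2 * (2 * (β + (β₁ + π * β))) * π) * cr := by
    have e1 : (Nov * (cι2 * (((1 - θA * cr)⁻¹ * βQ * cr) * rR + ((β + (β₁ + (π / w) * β)) * (1 - (β + (β₁ + (π / w) * β)) * (R * cr) * cr)⁻¹) * rR' + ((β + (β₁ + (π / w) * β)) * (1 - (β + (β₁ + (π / w) * β)) * (R * cr) * cr)⁻¹) * rB) * 1 + cι2 * ((β + (β₁ + (π / w) * β)) * (1 - (β + (β₁ + (π / w) * β)) * (R * cr) * cr)⁻¹) * (π / w))) * cr = Nov * (cι2 * ((X * rR + P * rR' + P * rB) * 1) + cι2 * P * (π / w)) * cr := by ring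
    have e2 : Nov * (cι2 * ((2 * βQ * cr) * rR + (2 * (β + (β₁ + π * β))) * rR' + (2 * (β + (β₁ + π * β))) * rB) + cι2 * (2 * (β + (β₁ + π * β))) * π) * cr =
        Nov * (cι2 * ((X₂ * rR + P₂ * rR' + P₂ * rB) * 1) + cι2 * P₂ * π) * cr := by rw [hX₂def, hP₂def]; ring
    rw [e1, e2]
    gcongr
  calc (1 - Nov * (cι2 * (((((cJ * (3 * ((β + (β₁ + (π / w) * β)) * (1 - (β + (β₁ + (π / w) * β)) * (R * cr) * cr)⁻¹ * (32 * π ^ 2 / w ^ 2)) + 2 * (((1 - θA * cr)⁻¹ * βQ * cr) * (π / w))) + 0)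
          + (β + (β₁ + (π / w) * β)) * (1 - (β + (β₁ + (π / w) * β)) * (R * cr) * cr)⁻¹ * ((π * D / w * 0 + 2 * (π * D / w)) * cN₀) * cr)
        + ((cJ * (2 * rV * ((π / w) * ((β + (β₁ + (π / w) * β)) * (1 - (β + (β₁ + (π / w) * β)) * (R * cr) * cr)⁻¹) + (π / w) * ((1 - θA * cr)⁻¹ * βQ * cr))))
          + (β + (β₁ + (π / w) * β)) * (1 - (β + (β₁ + (π / w) * β)) * (R * cr) * cr)⁻¹ * (((π * D / w) * (Real.exp 1 * ε)⁻¹ + 2 * (π * D / w)) * RN) * cr))) + (((β + (β₁ + (π / w) * β)) * (1 - (β + (β₁ + (π / w) * β)) * (R * cr) * cr)⁻¹) * θF * cr)) + cι2 * 0) * cr)⁻¹ * (Nov * (cι2 * (((1 - θA * cr)⁻¹ * βQ * cr) * rR + ((β + (β₁ + (π / w) * β)) * (1 - (β + (β₁ + (π / w) * β)) * (R * cr) * cr)⁻¹) * rR' + ((β + (β₁ + (π / w) * β)) * (1 - (β + (β₁ + (π / w) * β)) * (R * cr) * cr)⁻¹) * rB) * 1 + cι2 * ((β + (β₁ + (π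 / w) * β)) * (1 - (β + (β₁ + (π / w) * β)) * (R * cr) * cr)⁻¹) * (π / w))) * cr ≤ 2 * (Nov * (cι2 * (((1 - θA * cr)⁻¹ * βQ * cr) * rR + ((β + (β₁ + (π / w) * β)) * (1 - (β + (β₁ + (π / w) * β)) * (R * cr) * cr)⁻¹) * rR' + ((β + (β₁ + (π / w) * β)) * (1 - (β + (β₁ + (π / w) * β)) * (R * cr) * cr)⁻¹) * rB) * 1 + cι2 * ((β + (β₁ + (π / w) * β)) * (1 - (β + (β₁ + (π / w) * β)) * (R * cr) * cr)⁻¹) * (π / w))) * cr := mul_le_mul_of_nonneg_right (mul_le_mul_of_nonneg_right hI hN0) hcr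
    _ = 2 * ((Nov * (cι2 * (((1 - θA * cr)⁻¹ * βQ * cr) * rR + ((β + (β₁ + (π / w) * β)) * (1 - (β + (β₁ + (π / w) * β)) * (R * cr) * cr)⁻¹) * rR' + ((β + (β₁ + (π / w) * β)) * (1 - (β + (β₁ + (π / w) * β)) * (R * cr) * cr)⁻¹) * rB) * 1 + cι2 * ((β + (β₁ + (π / w) * β)) * (1 - (β + (β₁ + (π / w) * β)) * (R * cr) * cr)⁻¹) * (π / w))) * cr) := by ring
    _ ≤ _ := mul_le_mul_of_nonneg_left hF (by norm_num)

end Summit.QuantumFields.YangMills.BalabanUVNodes.N15.Gluing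

end
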